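import Mathlib.Analysis.Analytic.Order
import Mathlib.Analysis.Complex.ExponentialBounds
import Literature.NumberTheory.LFunctions.GaussianHeckeThetaMellin
import HarnessLib

/-!
# Zero-free region (Kubilius 1955) and zero density (Ricci 1976) for the Hecke `L`-functions
# `L(s, λ^k)` of `ℚ(i)`, as used by Huang–Liu–Rudnick 2020

Topic `NumberTheory/LFunctions`, next to `GaussianHeckeThetaMellin` (the entire continuation
`GaussianHecke.heckeL m` of `D_m(s) = ∑_{z ≠ 0} λ^m(z) N(z)^{-s} = 4 L(s, λ^m)`, `m ≥ 1`). NAMED FACTS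
(D-0014) requested by route `Parity/NeedleSectors` (layer-2 split of crux `SectorMobiusMeanSquare`;
calibration of stmt-Parity-0883/0884).

## Source (READ: arXiv:1903.04005 = Acta Arith. 193 (2020) 183–192, §2 in full)

B. Huang, J. Liu, Z. Rudnick, *Gaussian primes in almost all narrow sectors* [HuangLiuRudnick2020].
§2.1: for a nonzero ideal `𝔞 = (α) ⊆ ℤ[i]`, `Ξ_k(α) = (α/ᾱ)^{2k}` (`= e^{4ikθ_𝔞} = (α/|α|)^{4k}`,
the tree's `λ^k = angularChar`), `L(s, Ξ_k) = ∑_{𝔞 ≠ 0} Ξ_k(𝔞) N𝔞^{-s}` (`Re s > 1`), entire for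
`k ≠ 0` with `ξ(s,k) = π^{-(s+2|k|)} Γ(s+2|k|) L(s, Ξ_k) = ξ(1-s, k)`; hence
`GaussianHecke.heckeL k s = 4 L(s, Ξ_k)` (four associates per ideal) and the two functions have the
same zeros with the same multiplicities.

* **Theorem 2 (Kubilius 1955)** — "a 'non-standard' zero free region": *For `k > 0` and
  `V := √((T+2)² + (2k)²)`, if `ρ_{k,n} = β_{k,n} + iγ_{k,n}` is a zero of `L(s, Ξ_k)`, then
  `1 - β_{k,n} ≫ 1/(log V · log log V)^{3/4}`, `|γ_{k,n}| < T`.* (J. Kubilius, Vilniaus Valst.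
  Univ. Mokslo Darbai 4 (1955) 5–43; cf. Coleman, Mathematika 37 (1990) [ColemanMathematika1990].)
* **Theorem 3 (Ricci, thesis 1976)** — with
  `N(σ; T, K) := #{ρ_{k,n} = β_{k,n} + iγ_{k,n} : 0 < k ≤ K, |γ_{k,n}| < T, β_{k,n} ≥ σ}`:
  *For `σ ≥ 1/2`, `K, T ≥ 2` and `T = o(K)`, `N(σ; T, K) ≪ T K^{(10/3)(1-σ)} (log K)^B` for some
  `B > 0`.* (S. J. Ricci, *Local distribution of primes*, PhD thesis, Michigan 1976; cf. Harman,
  *Prime-detecting sieves*, Ch. 11 [Harman2007].)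

## Rendering

Zeros are counted WITH MULTIPLICITY through `analyticOrderAt` (the `L`-functions are entire for
`k ≥ 1`, `differentiable_heckeL`), the finitely many zeros in a box being summed with `finsum`
(`zeroCountIn`, `zeroCount`); the printed `≫` / `≪` are absolute implied constants (uniform in `k`,
`T`, `K`, `σ`, as the source uses them); "`T = o(K)`" is rendered by quantifying over functions
`T : ℕ → ℝ` with `T(K)/K → 0`, the implied constant of Thm. 3 being allowed to depend on that
function (and `B` not). Since `(T+2)² + (2k)² ≥ 8 > e²` for `T ≥ 0`, `k ≥ 1`, `log log V > 0` and
no junk value of `Real.log` is met in Thm. 2.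

## References

* [HuangLiuRudnick2020] Huang–Liu–Rudnick, Acta Arith. 193 (2020) 183–192, doi:10.4064/aa190331-23-7,
  arXiv:1903.04005 — §2.1 (Ξ_k, L(s, Ξ_k)), Thm. 2 (p. 4), Thm. 3 (p. 4).
* J. Kubilius (1955), loc. cit.; S. J. Ricci, PhD thesis, Univ. of Michigan (1976), loc. cit.
* [ColemanMathematika1990] M. D. Coleman, *A zero-free region for the Hecke L-functions*,
  Mathematika 37 (1990) 287–304; [Harman2007] G. Harman, *Prime-Detecting Sieves*, Ch. 11.
-/

noncomputable section

open Complex Filter Topology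

namespace Literature.NumberTheory.LFunctions

namespace GaussianHecke

/-- The number of zeros, counted with multiplicity, of `s ↦ D_k(s) = 4L(s, λ^k)`
(`GaussianHecke.heckeL k`) in the box `Re s ≥ σ`, `|Im s| < T`: the sum of the orders of vanishing
over the zeros in the box (`finsum`; the zero set of the entire, not identically zero `heckeL k`,
`k ≥ 1`, in a bounded box is finite; junk `0` otherwise). [cite: HuangLiuRudnick2020, §2.3 (definition of N(σ;T,K))] -/
def zeroCountIn (k : ℕ) (σ T : ℝ) : ℕ :=
  ∑ᶠ ρ ∈ {ρ : ℂ | heckeL k ρ = 0 ∧ σ ≤ ρ.re ∧ |ρ.im| < T}, (analyticOrderAt (heckeL k) ρ).toNat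

/-- Ricci's counting function `N(σ; T, K) = #{ρ = β + iγ : L(ρ, Ξ_k) = 0, 0 < k ≤ K, |γ| < T, β ≥ σ}`
(with multiplicity), summed over `1 ≤ k ≤ K`. [cite: HuangLiuRudnick2020, §2.3 (definition of N(σ;T,K))] -/
def zeroCount (σ T : ℝ) (K : ℕ) : ℕ :=
  ∑ k ∈ Finset.Icc 1 K, zeroCountIn k σ T

/-- Kubilius' parameter `V = √((T + 2)² + (2k)²)`. [cite: HuangLiuRudnick2020, Thm. 2] -/
def kubiliusV (k : ℕ) (T : ℝ) : ℝ :=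
  Real.sqrt ((T + 2) ^ 2 + (2 * k) ^ 2)

/-- NAMED FACT — **Kubilius' zero-free region for `L(s, Ξ_k)`** [HuangLiuRudnick2020, Thm. 2;
J. Kubilius 1955]: there is an absolute `c > 0` such that for every `k ≥ 1`, every `T ≥ 0` and every
zero `ρ = β + iγ` of `L(s, Ξ_k)` (equivalently of `GaussianHecke.heckeL k`) with `|γ| < T`,
`1 - β ≥ c / (log V · log log V)^{3/4}`, `V = √((T+2)² + (2k)²)`. (Trivial zeros `β ≤ -2k` satisfy
it trivially; the content is for the zeros in the critical strip.) Users take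
`(h : kubilius_zeroFreeRegion)`. [cite: HuangLiuRudnick2020, Thm. 2 (Kubilius 1955)] -/
def kubilius_zeroFreeRegion : Prop :=
  ∃ c : ℝ, 0 < c ∧ ∀ (k : ℕ), 1 ≤ k → ∀ (T : ℝ), 0 ≤ T → ∀ ρ : ℂ, heckeL k ρ = 0 → |ρ.im| < T →
    c / (Real.log (kubiliusV k T) * Real.log (Real.log (kubiliusV k T))) ^ (3 / 4 : ℝ) ≤ 1 - ρ.re

/-- NAMED FACT — **Ricci's zero-density estimate for the family `L(s, Ξ_k)`, `k ≤ K`**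
[HuangLiuRudnick2020, Thm. 3; S. J. Ricci, thesis 1976]: there is `B > 0` such that for every
`T = T(K) ≥ 2` with `T(K) = o(K)` there is `C` with
`N(σ; T(K), K) ≤ C · T(K) · K^{(10/3)(1-σ)} · (log K)^B` for all `K ≥ 2` and all `σ ≥ 1/2`
(`N` = `zeroCount`, zeros with multiplicity). Users take `(h : ricci_zeroDensity)`.
[cite: HuangLiuRudnick2020, Thm. 3 (Ricci 1976)] -/
def ricci_zeroDensity : Prop :=
  ∃ B : ℝ, 0 < B ∧ ∀ T : ℕ → ℝ, (∀ K, 2 ≤ T K) → Tendsto (fun K : ℕ => T K / K) atTop (𝓝 0) →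
    ∃ C : ℝ, ∀ (K : ℕ), 2 ≤ K → ∀ σ : ℝ, 1 / 2 ≤ σ →
      (zeroCount σ (T K) K : ℝ) ≤ C * T K * (K : ℝ) ^ ((10 / 3 : ℝ) * (1 - σ)) * Real.log K ^ B

/-! ### Sanity lemmas -/

/-- `V ≥ 2√2 > e` for `T ≥ 0` (so `log V > 1` and `log log V > 0`): `(T+2)² + (2k)² ≥ 4 + 4·0 ≥ 4`
already, and `≥ 8` for `k ≥ 1`. Here the weaker `V ≥ 2`. [folklore] -/
theorem two_le_kubiliusV (k : ℕ) {T : ℝ} (hT : 0 ≤ T) : 2 ≤ kubiliusV k T := by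
  unfold kubiliusV
  rw [Real.le_sqrt' (by norm_num : (0 : ℝ) < 2)]
  nlinarith [sq_nonneg (2 * (k : ℝ))]

/-- For `k ≥ 1`, `V² ≥ 8 > e²`, whence `log log V > 0`. Stated as `8 ≤ V²`. [folklore] -/
theorem eight_le_kubiliusV_sq {k : ℕ} (hk : 1 ≤ k) {T : ℝ} (hT : 0 ≤ T) : 8 ≤ kubiliusV k T ^ 2 := by
  unfold kubiliusV
  have hk' : (1 : ℝ) ≤ k := by exact_mod_cast hk
  rw [Real.sq_sqrt (by positivity)]
  nlinarith

/-- The counting function is monotone in `K`. [folklore] -/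
theorem zeroCount_mono (σ T : ℝ) : Monotone (zeroCount σ T) := by
  intro K K' h
  unfold zeroCount
  exact Finset.sum_le_sum_of_subset (Finset.Icc_subset_Icc_right h)

/-- Kubilius' region excludes zeros on the line `Re s = 1` (a weak consequence, for orientation; the
tree proves non-vanishing on `Re s = 1` unconditionally in `GaussianHeckeNonvanishing`).
Relies on: hypothesis `h`. [cite: HuangLiuRudnick2020, Thm. 2] -/
theorem kubilius_zeroFreeRegion.re_lt_one (h : kubilius_zeroFreeRegion) {k : ℕ} (hk : 1 ≤ k)
    {ρ : ℂ} (hρ : heckeL k ρ = 0) : ρ.re < 1 := by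
  obtain ⟨c, hc, hmain⟩ := h
  have hT : 0 ≤ |ρ.im| + 1 := by positivity
  have hb := hmain k hk (|ρ.im| + 1) hT ρ hρ (by linarith)
  have hV2 : 2 ≤ kubiliusV k (|ρ.im| + 1) := two_le_kubiliusV k hT
  have hV8 : 8 ≤ kubiliusV k (|ρ.im| + 1) ^ 2 := eight_le_kubiliusV_sq hk hT
  -- `log V > 1` since `V² ≥ 8 > e²`
  have hlogV : 1 < Real.log (kubiliusV k (|ρ.im| + 1)) := by
    rw [Real.lt_log_iff_exp_lt (by linarith)]
    have he : Real.exp 1 < 2.7182818286 := Real.exp_one_lt_d9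
    nlinarith [Real.exp_pos 1]
  have hloglog : 0 < Real.log (Real.log (kubiliusV k (|ρ.im| + 1))) := Real.log_pos hlogV
  have hden : 0 < (Real.log (kubiliusV k (|ρ.im| + 1)) *
      Real.log (Real.log (kubiliusV k (|ρ.im| + 1)))) ^ (3 / 4 : ℝ) :=
    Real.rpow_pos_of_pos (mul_pos (by linarith) hloglog) _
  have hpos : 0 < c / (Real.log (kubiliusV k (|ρ.im| + 1)) *
      Real.log (Real.log (kubiliusV k (|ρ.im| + 1)))) ^ (3 / 4 : ℝ) := div_pos hc hden
  linarith

end GaussianHecke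

end Literature.NumberTheory.LFunctions

end
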